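import Summits.CriticalPhenomena.Ising3DConformalLimit.Theorems.UnitLightConeTwoPointIsotropyToAllN
import Summits.CriticalPhenomena.Ising3DConformalLimit.Theorems.RotationUpgradeFromTwoPoint.Negative.LoadBearingHypotheses
import Summits.CriticalPhenomena.Ising3DConformalLimit.Theorems.RotationUpgradeFromTwoPoint.Negative.NondegeneracyRedundant
import HarnessLib

/-!
# Disproof of `TwoPointIsotropyToAllN` — findings: NO KILL IS POSSIBLE, the crux is a kernel-checked THEOREM

Crux disprover (cdisprove, cycle 1, 2026-08-17) for item stmt-CriticalPhenomena-17168 =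
`Summit.CriticalPhenomena.Ising3DConformalLimit.Theses.UnitLightCone.TwoPointIsotropyToAllN`
(route `route-CriticalPhenomena-UnitLightCone`, crux (N), rank 3).

Hypotheses on `(ρ, Δ, S)`: (H1) `ρ > 0` on `(0,1]`; (H2) `HasPointwiseScalingLimit (criticalCorr 3) ρ S`;
(H3) `S = 0` off `NonCoincident`; (H4) `IsNondegenerateTwoPoint S`; (H5) `IsTranslationInvariant S`;
(H6) `IsScaleCovariant Δ S`; (H7) two-point isotropy `∀ R x, S 2 ![0, R x] = S 2 ![0, x]` (NO `x ≠ 0` guard);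
conclusion `IsRotationInvariant S`.

## Findings (everything below is sorry-free and kernel-checked)

1. **The crux is TRUE — closed · proved** by
   `Summit.CriticalPhenomena.Ising3DConformalLimit.Theorems.UnitLightConeTwoPointIsotropyToAllN.twoPointIsotropyToAllN_proof`
   (p157716 @ e8ec1324a31c, 2026-08-17T11:34Z, 100 s before this seat was armed), a 2-line transport of the landed sibling
   theorem `Cruxes.RotationUpgradeFromTwoPoint.NullLaplacianEdgeGaussianity.rotationUpgradeFromTwoPoint_proof`
   (stmt-CriticalPhenomena-8367).  Re-verified here: `crux_holds` below elaborates, `#print axioms` ⊆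
   {propext, Classical.choice, Quot.sound}.  Hence `crux_irrefutable : ¬ ¬ TwoPointIsotropyToAllN`: no counterexample,
   degenerate instance, junk model or barrier can refute the statement AS TYPED — every attack below is therefore
   redirected to the LOAD-BEARING ANALYSIS (which hypotheses any proof must use) and to NATURAL STRENGTHENINGS.
2. **`crux_iff_sibling`**: the crux and `GaussianScaleMixture.RotationUpgradeFromTwoPoint` are equivalent propositions
   (the sibling's guard `x ≠ 0` in (H7) is vacuous: a linear isometry fixes `0`).  So the sibling's standing-disprover
   file family `Theorems/RotationUpgradeFromTwoPoint/Negative/*.lean` applies verbatim; the transports are recorded here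
   in THIS crux's (guard-free) shape.
3. **(H2) is load-bearing at every `Δ ≠ 0`** — `twoPointIsotropyToAllN_false_without_IsingLimit`: the cubic decoy
   `cubicFamily Δ` (round `S₂ = ‖x‖^{-2Δ}`, anisotropic `S₄`) has (H3)–(H7) and is not rotation invariant.  This is the
   planner's own "model-blind it is false" remark, now a theorem for this decl.
4. **The natural strengthening "any lattice scaling limit" is FALSE** — `not_twoPointIsotropyToAllN_latticeStrengthening`
   (`Δ ≠ 0`): replacing `criticalCorr 3` by an arbitrary `LatticeCorrFamily 3` is refuted by the decoy, which is the
   scaling limit of its own sampling on `ℤ³`.  A proof must use an Ising-specific property the decoy lacks (it is not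
   reflection positive: `cubicFamily_not_reflectionPositive`); the landed proof indeed runs through nine-mirror OS
   positivity of all orders + sigma bounds + the quarter-turn Liouville graft.
5. **(H3) is load-bearing** granted existence — `twoPointIsotropyToAllN_false_without_Normalisation`
   (modulo `CritIsing3DEuclideanLimit`): decorate `S₃` on the coincident locus, invisible to (H2).
6. **(H4), (H5), (H6) and the `Δ`-binder are REDUNDANT** — `crux_iff_withoutNondegeneracy'`, `crux_iff_core'`:
   information for readers of the route (the same three hypotheses decorate UnitSpeedTwoPoint / LightConeRoundness).
7. **Non-vacuity** — `exists_hyp_of_euclideanLimit'`: granted `CritIsing3DEuclideanLimit` the seven hypotheses are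
   jointly satisfiable (by a rotation-invariant instance); absolutely, satisfiability of (H1)–(H6) is exactly the open
   crux `ExistsScaleCovariantLimit` (stmt-1981) plus (H7).  The proof in tree is NOT a proof by vacuity: it case-splits on
   `HasNontrivialU4 S` and treats the Gaussian locus by Wick's rule.

Attacks that are moot for a proved statement and were therefore not run: finite-model / `decide` searches (no finite
shape), `kit compute` numerics, literature counterexample hunts.  Nothing in `ledger negatives --problem
CriticalPhenomena` touches this decl.  No `sorry` in this file.
-/

noncomputable section

namespace Summit.CriticalPhenomena.Ising3DConformalLimit.Cruxes.TwoPointIsotropyToAllN.Disproof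

open Literature.Probability.LatticeModels
open Summit.CriticalPhenomena.Ising3DConformalLimit.Theses.UnitLightCone (TwoPointIsotropyToAllN)
open Summit.CriticalPhenomena.Ising3DConformalLimit.Theses.GaussianScaleMixture (RotationUpgradeFromTwoPoint)
open Summit.CriticalPhenomena.Ising3DConformalLimit.Theorems.UnitLightConeTwoPointIsotropyToAllN
open Summit.CriticalPhenomena.Ising3DConformalLimit.RotationUpgradeFromTwoPointNegative

local notation "E³" => EuclideanSpace ℝ (Fin 3)

/-! ## 1. The crux holds (so it cannot be refuted) -/

/-- The crux is a theorem of the tree (closing theorem `twoPointIsotropyToAllN_proof`, item closed · proved). -/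
theorem crux_holds : TwoPointIsotropyToAllN := twoPointIsotropyToAllN_proof

/-- Consequently no refutation `¬ TwoPointIsotropyToAllN` exists (short of an inconsistency in Lean + Mathlib). -/
theorem crux_irrefutable : ¬ ¬ TwoPointIsotropyToAllN := fun h => h crux_holds

/-! ## 2. Equivalence with the sibling crux (guard `x ≠ 0` is vacuous) -/

/-- The guard-free two-point isotropy (H7) of this crux from the sibling's guarded form: `R 0 = 0`. -/
theorem iso_of_guarded {S : CorrFamily 3}
    (h : ∀ (R : E³ ≃ₗᵢ[ℝ] E³) (x : E³), x ≠ 0 → S 2 ![0, R x] = S 2 ![0, x]) :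
    ∀ (R : E³ ≃ₗᵢ[ℝ] E³) (x : E³), S 2 ![0, R x] = S 2 ![0, x] := by
  intro R x
  by_cases hx : x = 0
  · subst hx
    rw [map_zero]
  · exact h R x hx

/-- `TwoPointIsotropyToAllN ↔ RotationUpgradeFromTwoPoint` (both directions landed in the closing file). -/
theorem crux_iff_sibling : TwoPointIsotropyToAllN ↔ RotationUpgradeFromTwoPoint :=
  ⟨rotationUpgrade_of_twoPointIsotropyToAllN, TwoPointIsotropyToAllN_of_rotationUpgrade⟩

/-! ## 3. Load-bearing analysis, (a): hypotheses any proof must use -/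

/-- The crux with the Ising clauses (H1)+(H2) DELETED (model-blind form, fixed exponent `Δ`). -/
def TwoPointIsotropyToAllNWithoutIsingLimit (Δ : ℝ) : Prop :=
  ∀ S : CorrFamily 3, (∀ n z, z ∉ NonCoincident 3 n → S n z = 0) → IsNondegenerateTwoPoint S →
    IsTranslationInvariant S → IsScaleCovariant Δ S →
    (∀ (R : E³ ≃ₗᵢ[ℝ] E³) (x : E³), S 2 ![0, R x] = S 2 ![0, x]) → IsRotationInvariant S

/-- **(H2) is load-bearing at every `Δ ≠ 0`**: the model-blind crux is false, witness the cubic decoy `cubicFamily Δ`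
(round two-point function, `S₄` with a cubic-harmonic anisotropy).  Transport of `not_cruxWithoutIsingLimit`. -/
theorem twoPointIsotropyToAllN_false_without_IsingLimit {Δ : ℝ} (hΔ : Δ ≠ 0) :
    ¬ TwoPointIsotropyToAllNWithoutIsingLimit Δ := fun h =>
  not_cruxWithoutIsingLimit hΔ fun S h3 h4 h5 h6 h7 => h S h3 h4 h5 h6 (iso_of_guarded h7)

/-- The crux with the normalisation (H3) DELETED. -/
def TwoPointIsotropyToAllNWithoutNormalisation : Prop :=
  ∀ (ρ : ℝ → ℝ) (Δ : ℝ) (S : CorrFamily 3), (∀ δ ∈ Set.Ioc (0:ℝ) 1, 0 < ρ δ) →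
    HasPointwiseScalingLimit (criticalCorr 3) ρ S → IsNondegenerateTwoPoint S →
    IsTranslationInvariant S → IsScaleCovariant Δ S →
    (∀ (R : E³ ≃ₗᵢ[ℝ] E³) (x : E³), S 2 ![0, R x] = S 2 ![0, x]) → IsRotationInvariant S

/-- **(H3) is load-bearing** granted that the intended object exists (`CritIsing3DEuclideanLimit`, the Euclidean half of
the summit conjunct): decorate `S₃` on the coincident locus.  Transport of `not_cruxWithoutNormalisation`.  (A lemma
MODULO an unconstructed hypothesis — it changes no verdict.) -/
theorem twoPointIsotropyToAllN_false_without_Normalisation (hE : CritIsing3DEuclideanLimit) :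
    ¬ TwoPointIsotropyToAllNWithoutNormalisation := fun h =>
  not_cruxWithoutNormalisation hE fun ρ Δ S h1 h2 h4 h5 h6 h7 => h ρ Δ S h1 h2 h4 h5 h6 (iso_of_guarded h7)

/-! ## 4. Natural strengthening refuted, (c): lattice provenance is not enough -/

/-- **Strengthening to an ARBITRARY lattice scaling limit is false** (`Δ ≠ 0`): the decoy is the pointwise scaling
limit of its own sampling on `ℤ³` (`cubicLattice Δ`, `ρ δ = δ^{-Δ}`).  Transport of `not_cruxWithLatticeLimit`. -/
theorem not_twoPointIsotropyToAllN_latticeStrengthening {Δ : ℝ} (hΔ : Δ ≠ 0) :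
    ¬ ∀ (G : LatticeCorrFamily 3) (ρ : ℝ → ℝ) (S : CorrFamily 3), (∀ δ ∈ Set.Ioc (0:ℝ) 1, 0 < ρ δ) →
      HasPointwiseScalingLimit G ρ S → (∀ n z, z ∉ NonCoincident 3 n → S n z = 0) →
      IsNondegenerateTwoPoint S → IsTranslationInvariant S → IsScaleCovariant Δ S →
      (∀ (R : E³ ≃ₗᵢ[ℝ] E³) (x : E³), S 2 ![0, R x] = S 2 ![0, x]) → IsRotationInvariant S := fun h =>
  not_cruxWithLatticeLimit hΔ fun G ρ S h1 h2 h3 h4 h5 h6 h7 => h G ρ S h1 h2 h3 h4 h5 h6 (iso_of_guarded h7)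

/-! ## 5. Redundant hypotheses (information only) -/

/-- **(H4) is redundant**: the crux is equivalent to its version without non-degeneracy. -/
theorem crux_iff_withoutNondegeneracy' :
    TwoPointIsotropyToAllN ↔
      ∀ (ρ : ℝ → ℝ) (Δ : ℝ) (S : CorrFamily 3), (∀ δ ∈ Set.Ioc (0:ℝ) 1, 0 < ρ δ) →
        HasPointwiseScalingLimit (criticalCorr 3) ρ S → (∀ n z, z ∉ NonCoincident 3 n → S n z = 0) →
        IsTranslationInvariant S → IsScaleCovariant Δ S →
        (∀ (R : E³ ≃ₗᵢ[ℝ] E³) (x : E³), x ≠ 0 → S 2 ![0, R x] = S 2 ![0, x]) → IsRotationInvariant S :=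
  crux_iff_sibling.trans crux_iff_withoutNondegeneracy

/-- **(H5), (H6) and the `Δ`-binder are redundant**: the crux is equivalent to its `Δ`-free core. -/
theorem crux_iff_core' :
    TwoPointIsotropyToAllN ↔
      ∀ (ρ : ℝ → ℝ) (S : CorrFamily 3), (∀ δ ∈ Set.Ioc (0:ℝ) 1, 0 < ρ δ) →
        HasPointwiseScalingLimit (criticalCorr 3) ρ S → (∀ n z, z ∉ NonCoincident 3 n → S n z = 0) →
        IsNondegenerateTwoPoint S →
        (∀ (R : E³ ≃ₗᵢ[ℝ] E³) (x : E³), x ≠ 0 → S 2 ![0, R x] = S 2 ![0, x]) → IsRotationInvariant S :=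
  crux_iff_sibling.trans crux_iff_core

/-! ## 6. Non-vacuity (relative to existence) -/

/-- Granted `CritIsing3DEuclideanLimit`, all seven hypotheses of the crux are jointly satisfiable, by a rotation-invariant
instance (transport of `exists_hyp_of_euclideanLimit`). -/
theorem exists_hyp_of_euclideanLimit' (hE : CritIsing3DEuclideanLimit) :
    ∃ (ρ : ℝ → ℝ) (Δ : ℝ) (S : CorrFamily 3), (∀ δ ∈ Set.Ioc (0:ℝ) 1, 0 < ρ δ) ∧
      HasPointwiseScalingLimit (criticalCorr 3) ρ S ∧ (∀ n z, z ∉ NonCoincident 3 n → S n z = 0) ∧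
      IsNondegenerateTwoPoint S ∧ IsTranslationInvariant S ∧ IsScaleCovariant Δ S ∧
      (∀ (R : E³ ≃ₗᵢ[ℝ] E³) (x : E³), S 2 ![0, R x] = S 2 ![0, x]) ∧ IsRotationInvariant S := by
  obtain ⟨ρ, Δ, S, h1, h2, h3, h4, h5, h6, h7, h8⟩ := exists_hyp_of_euclideanLimit hE
  exact ⟨ρ, Δ, S, h1, h2, h3, h4, h5, h6, iso_of_guarded h7, h8⟩

-- Targets: none (payload.stuck_stubs = [], the picked line `Sketch`/`birth` has 0 stubs and is landed).

end Summit.CriticalPhenomena.Ising3DConformalLimit.Cruxes.TwoPointIsotropyToAllN.Disproof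

end
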